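import Summits.QuantumFields.YangMills.Theorems.BalabanUVNodesN19TargetOfDecorrelationReadingWitness

/-!
# YM-DAG node N19 (= NE7 proper) — THE AGING LETTER FROM MIXING AND LOCALITY: the conditional class-blindness of the loop response (FILE D §4's
# hypothesis, hence the decorrelation letter (DC) of FILE C) follows from two ONE-RUN letters — (MIX) run A's source-free class law is a QUASI-PRODUCT of
# its old and recent coordinates, and (LOC) the loop's response reads the recent coordinate only, up to `e^{±s'}`; so node U5's `Target` is reached from
# (RM) + (MIX) + (LOC) with NO class-uniform constant and NO hypothesis on the two-run contrast of old structure

Cell `pub-ymgap`, HUMAN RULING D-0062 (Track A), width seat `pub-ymgap-dag-n19-w2` (node n19 = NE7), generation g7 (R455 (A) rule (ii); CLAIM-5 on the cell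
bus).  Route `Summits/QuantumFields/YangMills/Theses/BalabanUVNodes.lean`, key item K3⁸ `SpineGivenEndpointR13SepCoPHV` (stmt-QuantumFields-27366; aside
predecessor K3⁷ 20544); filed `--kind proof --supports … --as helper`.  COUNT-NEUTRAL.  THEOREMS ONLY (0 `def`, 0 `sorry`).  v1 p629666 (§1–§4); v1.1 = + §5, v1's declarations byte-identical.  ADDITIVE — imports this seat's
FILE D `…N19TargetOfDecorrelationReadingWitness` (p627614: `decorrelation_of_conditionallyBlindResponse`) and through it FILE C (p625854:
`abs_log_sum_sub_log_sum_sub_le`, `target_of_responseDecorrelationReading`); modifies nothing.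

WHERE THIS SITS.  FILE C: `Target ⇐ (RM) + (DC)`.  FILE D §4: `(DC) ⇐` «the loop response, averaged over the RECENT coordinate, is blind to the OLD
coordinate» (hCB, radius `s`), for ANY source-free weights and ANY old-coordinate contrast.  THIS FILE derives hCB from two one-run letters that name the
physics: (MIX) `A_0(τ₁, τ₂) = a₁(τ₁)·μ(τ₂)·e^{±s∕2}` — run A's source-free class law is a QUASI-PRODUCT of old and recent structure (a mixing ∕ decoupling
statement across scales: the recent structure's conditional law given the old one is the reference law `μ` up to `e^{±s}`); (LOC) `A_t∕A_0 (τ₁, τ₂) =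
ρ̄_t(τ₂)·e^{±s'}` — the loop's source response reads the recent coordinate only (in the class-gas reading of FILES A∕B∕E this is E's
`responseMatching_of_classGas` applied to TWO OLD COORDINATES OF ONE RUN instead of two runs: source-free prefactors cancel, and `s'` is the class
discrepancy of the activities DISCOUNTED by the decay-distance to the loop — cited, not restated).  Then hCB holds with radius `s + s'` and reference
response `φ(t) = log Σ_{τ₂} μ ρ̄_t − log Σ_{τ₂} μ` (§1), (DC) holds with `κ = 2(s + s')` (§2), and along `K` node U5's `Target` follows from (RM) + (MIX) + (LOC)
with `r_K + 2(s_K + s'_K) ≤ vol·δ_K`, `Σ δ_K < ∞` (§3).  Neither letter compares the two runs' OLD structure: the extensive, law-separating old-block contrast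
of the crux card window-key-core is simply absent from the hypotheses.

WHAT IS KERNEL-CHECKED ([folklore] finite sums; the imported lemmas BY NAME).
* §1 ★ `conditionallyBlind_of_quasiProduct_of_localResponse` — (MIX) + (LOC) ⇒ hCB with `s + s'`.
* §2 ★ `decorrelation_of_quasiProduct_of_localResponse` — … ⇒ (DC) with `κ = 2(s + s')`, for any contrast `B_0 = u(τ₁)·A_0` on the old coordinate
  (FILE D §4 BY NAME).
* §3 ★★ `target_of_mixingLocalityReading` — ALONG `K`: classes `T₁ K ×ˢ T₂ K`, positive weights, the dictionary E1∕E2, (RM)_K with `r K`, contrast on the old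
  coordinate, (MIX)_K with `s K`, (LOC)_K with `s' K`, `r K + 2(s K + s' K) ≤ vol·δ K`, `Summable δ` ⇒ `NE7.Target vol l₀ δ Z` (FILE C's
  `target_of_responseDecorrelationReading` BY NAME).
* §4 SANITY (A6): the exact product with a recent-only response inhabits (MIX) and (LOC) with `s = s' = 0` (`example`).
* §5 (v1.1, APPEND-ONLY) ★ `decorrelation_of_quasiProduct_of_localResponse_of_quasiOldContrast` — the contrast reads the old coordinate only UP TO `ζ`
  (`|log B_0 − log(u(τ₁)A_0)| ≤ ζ`: recent two-run contrast + both runs' two-hole errors) ⇒ (DC) with `κ = 2(s + s' + ζ)` — the form FILE H's class-gas letters feed.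

HONEST FRAMING.  (RM), (MIX), (LOC), the old∕recent product indexing and the «contrast on the old coordinate» clause are HYPOTHESIS SHAPES on positive finite
class weights, produced by nobody for Bałaban's runs — (MIX) is an unprinted cross-scale decoupling statement about ONE run's large-field class law, (LOC) an
unprinted locality statement about ONE run's loop response; whether the spine reading of record admits an old∕recent indexing with these letters is a question
for the n19∕n20∕NODE-O lanes and the crux cards, NOT answered here.  ZERO Bałaban content; NE7 ∕ NE7b NOT PRINTED for d = 4 ∕ NOT proved; N19 ∕ N20 NOT
discharged; K3⁸ 27366 OPEN, not claimed — K3's stub 2 is typed on the `Core` road and NOT served here; counts UNMOVED (typed 28∕28 · discharged 5∕27, A 5∕28);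
no count claim.  One finite four-torus programme at fixed ε; R4 closes the conditional finite-𝕋⁴ rung `BalabanLadder.UV` only — NOT infinite volume, NOT OS
on ℝ⁴, NOT the Yang–Mills mass gap, NOT the Clay problem.  0 `def`; 0 `sorry`; standard axioms.
-/

noncomputable section

open Finset
open scoped BigOperators

namespace Summit.QuantumFields.YangMills.BalabanUVNodes.N19AgingLetterOfMixingLocality

open Summit.QuantumFields.BalabanUV.T4Continuum.Spine
open Summit.QuantumFields.YangMills.BalabanUVNodes.N19TargetOfDecorrelationReading (abs_log_sum_sub_log_sum_sub_le target_of_responseDecorrelationReading)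
open Summit.QuantumFields.YangMills.BalabanUVNodes.N19TargetOfDecorrelationReadingWitness (decorrelation_of_conditionallyBlindResponse)

variable {ι₁ ι₂ : Type*}

/-! ## §1 (MIX) + (LOC) ⇒ the conditional class-blindness of the loop response -/

section OneStep

variable {T₁ : Finset ι₁} {T₂ : Finset ι₂} {A B : ℝ → ι₁ × ι₂ → ℝ} {a₁ u : ι₁ → ℝ} {μ : ι₂ → ℝ} {ρbar : ℝ → ι₂ → ℝ} {l₀ s s' : ℝ}

/-- **CONDITIONAL CLASS-BLINDNESS FROM A QUASI-PRODUCT CLASS LAW AND A LOCAL RESPONSE.**  Classes `T₁ ×ˢ T₂` (old × recent coordinate), positive weights.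
(MIX) `|log A_0(τ₁,τ₂) − log(a₁ τ₁ · μ τ₂)| ≤ s∕2` (run A's source-free class law is a quasi-product: conditionally on the old coordinate the recent one has
law `μ` up to `e^{±s}`); (LOC) `|log A_t(τ) − log A_0(τ) − log ρ̄_t(τ₂)| ≤ s'` (the response reads the recent coordinate only, up to `e^{±s'}`).  Then for every
old coordinate `τ₁`: `|log Σ_{τ₂} A_t(τ₁,τ₂) − log Σ_{τ₂} A_0(τ₁,τ₂) − φ(t)| ≤ s + s'` with `φ(t) = log Σ_{τ₂} μ ρ̄_t − log Σ_{τ₂} μ` — FILE D §4's hypothesis. [folklore] -/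
theorem conditionallyBlind_of_quasiProduct_of_localResponse (hT₂ : T₂.Nonempty)
    (hA : ∀ t, |t| ≤ l₀ → ∀ τ ∈ T₁ ×ˢ T₂, 0 < A t τ) (hl₀ : 0 ≤ l₀) (ha₁ : ∀ τ₁ ∈ T₁, 0 < a₁ τ₁) (hμ : ∀ τ₂ ∈ T₂, 0 < μ τ₂)
    (hρ : ∀ t, |t| ≤ l₀ → ∀ τ₂ ∈ T₂, 0 < ρbar t τ₂)
    (hMIX : ∀ τ ∈ T₁ ×ˢ T₂, |Real.log (A 0 τ) - Real.log (a₁ τ.1 * μ τ.2)| ≤ s / 2)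
    (hLOC : ∀ t, |t| ≤ l₀ → ∀ τ ∈ T₁ ×ˢ T₂, |Real.log (A t τ) - Real.log (A 0 τ) - Real.log (ρbar t τ.2)| ≤ s')
    {t : ℝ} (ht : |t| ≤ l₀) {τ₁ : ι₁} (hτ₁ : τ₁ ∈ T₁) :
    |Real.log (∑ τ₂ ∈ T₂, A t (τ₁, τ₂)) - Real.log (∑ τ₂ ∈ T₂, A 0 (τ₁, τ₂)) -
        (Real.log (∑ τ₂ ∈ T₂, μ τ₂ * ρbar t τ₂) - Real.log (∑ τ₂ ∈ T₂, μ τ₂))| ≤ s + s' := by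
  have h0 : |(0 : ℝ)| ≤ l₀ := by simpa using hl₀
  have hmem : ∀ τ₂ ∈ T₂, (τ₁, τ₂) ∈ T₁ ×ˢ T₂ := fun τ₂ hτ₂ => Finset.mem_product.2 ⟨hτ₁, hτ₂⟩
  -- (i) the source-`t` row against `a₁ τ₁ · μ · ρ̄_t`
  have h1 : |Real.log (∑ τ₂ ∈ T₂, A t (τ₁, τ₂)) - Real.log (∑ τ₂ ∈ T₂, a₁ τ₁ * (μ τ₂ * ρbar t τ₂)) - 0| ≤ s / 2 + s' := by
    refine abs_log_sum_sub_log_sum_sub_le hT₂ (fun τ₂ hτ₂ => mul_pos (ha₁ τ₁ hτ₁) (mul_pos (hμ τ₂ hτ₂) (hρ t ht τ₂ hτ₂)))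
      (fun τ₂ hτ₂ => hA t ht _ (hmem τ₂ hτ₂)) fun τ₂ hτ₂ => ?_
    have hx : Real.log (a₁ τ₁ * (μ τ₂ * ρbar t τ₂)) = Real.log (a₁ τ₁ * μ τ₂) + Real.log (ρbar t τ₂) := by
      rw [← mul_assoc, Real.log_mul (mul_pos (ha₁ τ₁ hτ₁) (hμ τ₂ hτ₂)).ne' (hρ t ht τ₂ hτ₂).ne']
    rw [hx, sub_zero]
    have e : Real.log (A t (τ₁, τ₂)) - (Real.log (a₁ τ₁ * μ τ₂) + Real.log (ρbar t τ₂)) =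
        (Real.log (A t (τ₁, τ₂)) - Real.log (A 0 (τ₁, τ₂)) - Real.log (ρbar t τ₂)) +
          (Real.log (A 0 (τ₁, τ₂)) - Real.log (a₁ τ₁ * μ τ₂)) := by ring
    rw [e]
    calc _ ≤ |Real.log (A t (τ₁, τ₂)) - Real.log (A 0 (τ₁, τ₂)) - Real.log (ρbar t τ₂)| +
          |Real.log (A 0 (τ₁, τ₂)) - Real.log (a₁ τ₁ * μ τ₂)| := abs_add_le _ _
      _ ≤ s' + s / 2 := add_le_add (hLOC t ht _ (hmem τ₂ hτ₂)) (hMIX _ (hmem τ₂ hτ₂))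
      _ = s / 2 + s' := by ring
  -- (ii) the source-free row against `a₁ τ₁ · μ`
  have h2 : |Real.log (∑ τ₂ ∈ T₂, A 0 (τ₁, τ₂)) - Real.log (∑ τ₂ ∈ T₂, a₁ τ₁ * μ τ₂) - 0| ≤ s / 2 := by
    refine abs_log_sum_sub_log_sum_sub_le hT₂ (fun τ₂ hτ₂ => mul_pos (ha₁ τ₁ hτ₁) (hμ τ₂ hτ₂)) (fun τ₂ hτ₂ => hA 0 h0 _ (hmem τ₂ hτ₂))
      fun τ₂ hτ₂ => ?_
    rw [sub_zero]; exact hMIX _ (hmem τ₂ hτ₂)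
  -- factor `a₁ τ₁` out of the reference rows
  have hμρ : 0 < ∑ τ₂ ∈ T₂, μ τ₂ * ρbar t τ₂ := Finset.sum_pos (fun τ₂ hτ₂ => mul_pos (hμ τ₂ hτ₂) (hρ t ht τ₂ hτ₂)) hT₂
  have hμs : 0 < ∑ τ₂ ∈ T₂, μ τ₂ := Finset.sum_pos hμ hT₂
  rw [← Finset.mul_sum, Real.log_mul (ha₁ τ₁ hτ₁).ne' hμρ.ne', sub_zero] at h1
  rw [← Finset.mul_sum, Real.log_mul (ha₁ τ₁ hτ₁).ne' hμs.ne', sub_zero] at h2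
  rw [abs_le] at h1 h2 ⊢
  constructor <;> linarith [h1.1, h1.2, h2.1, h2.2]

/-! ## §2 … hence the decorrelation letter (DC), for any contrast on the old coordinate -/

/-- **(DC) FROM (MIX) + (LOC)** (`κ = 2(s + s')`): with the two-run source-free contrast reading the old coordinate only (`B_0 = u(τ₁)·A_0`, `u > 0`, however
large and law-separating), FILE D §4's `decorrelation_of_conditionallyBlindResponse` at the conditional blindness of §1. [folklore] -/
theorem decorrelation_of_quasiProduct_of_localResponse (hT₁ : T₁.Nonempty) (hT₂ : T₂.Nonempty)
    (hA : ∀ t, |t| ≤ l₀ → ∀ τ ∈ T₁ ×ˢ T₂, 0 < A t τ) (hl₀ : 0 ≤ l₀) (ha₁ : ∀ τ₁ ∈ T₁, 0 < a₁ τ₁) (hμ : ∀ τ₂ ∈ T₂, 0 < μ τ₂)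
    (hρ : ∀ t, |t| ≤ l₀ → ∀ τ₂ ∈ T₂, 0 < ρbar t τ₂) (hu : ∀ τ₁ ∈ T₁, 0 < u τ₁)
    (hB0 : ∀ τ ∈ T₁ ×ˢ T₂, B 0 τ = u τ.1 * A 0 τ)
    (hMIX : ∀ τ ∈ T₁ ×ˢ T₂, |Real.log (A 0 τ) - Real.log (a₁ τ.1 * μ τ.2)| ≤ s / 2)
    (hLOC : ∀ t, |t| ≤ l₀ → ∀ τ ∈ T₁ ×ˢ T₂, |Real.log (A t τ) - Real.log (A 0 τ) - Real.log (ρbar t τ.2)| ≤ s')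
    {t : ℝ} (ht : |t| ≤ l₀) :
    |Real.log (∑ τ ∈ T₁ ×ˢ T₂, B 0 τ * (A t τ / A 0 τ)) - Real.log (∑ τ ∈ T₁ ×ˢ T₂, B 0 τ) -
        (Real.log (∑ τ ∈ T₁ ×ˢ T₂, A t τ) - Real.log (∑ τ ∈ T₁ ×ˢ T₂, A 0 τ))| ≤ 2 * (s + s') :=
  decorrelation_of_conditionallyBlindResponse hT₁ hT₂ hA hl₀ hu hB0
    (φ := fun t => Real.log (∑ τ₂ ∈ T₂, μ τ₂ * ρbar t τ₂) - Real.log (∑ τ₂ ∈ T₂, μ τ₂))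
    (fun _ ht' _ hτ₁ => conditionallyBlind_of_quasiProduct_of_localResponse hT₂ hA hl₀ ha₁ hμ hρ hMIX hLOC ht' hτ₁) ht

end OneStep

/-! ## §3 ALONG `K`: (RM) + (MIX) + (LOC) ⇒ node U5's `Target` — no class-uniform constant, no hypothesis on the old-structure contrast -/

section AlongK

variable {vol l₀ : ℝ} {δ : ℕ → ℝ} {Z : ℕ → ℝ → ℝ}

/-- **NODE U5's `Target` FROM RESPONSE MATCHING, MIXING AND LOCALITY.**  Along `K`: classes `T₁ K ×ˢ T₂ K` (old × recent), positive weights `A K t`, `B K t`;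
the dictionary `Z K t = Σ A K t`, `Z (K+1) t = Σ B K t` on `|t| ≤ l₀`; (RM)_K two-run matching of the responses class by class (radius `r K`); the two-run
source-free contrast on the old coordinate (`B K 0 = u K(τ₁)·A K 0`); (MIX)_K quasi-product law (`s K`); (LOC)_K recent-only response (`s' K`); budgets
`r K + 2(s K + s' K) ≤ vol·δ K`, `Summable δ` ⇒ `NE7.Target vol l₀ δ Z` (FILE C's `target_of_responseDecorrelationReading` BY NAME). [folklore] -/
theorem target_of_mixingLocalityReading (hl₀ : 0 ≤ l₀) (T₁ : ℕ → Finset ι₁) (T₂ : ℕ → Finset ι₂) (A B : ℕ → ℝ → ι₁ × ι₂ → ℝ)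
    (a₁ u : ℕ → ι₁ → ℝ) (μ : ℕ → ι₂ → ℝ) (ρbar : ℕ → ℝ → ι₂ → ℝ) (r s s' : ℕ → ℝ)
    (hT₁ : ∀ K, (T₁ K).Nonempty) (hT₂ : ∀ K, (T₂ K).Nonempty)
    (hA : ∀ K t, |t| ≤ l₀ → ∀ τ ∈ T₁ K ×ˢ T₂ K, 0 < A K t τ) (hB : ∀ K t, |t| ≤ l₀ → ∀ τ ∈ T₁ K ×ˢ T₂ K, 0 < B K t τ)
    (ha₁ : ∀ K, ∀ τ₁ ∈ T₁ K, 0 < a₁ K τ₁) (hμ : ∀ K, ∀ τ₂ ∈ T₂ K, 0 < μ K τ₂) (hρ : ∀ K t, |t| ≤ l₀ → ∀ τ₂ ∈ T₂ K, 0 < ρbar K t τ₂)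
    (hu : ∀ K, ∀ τ₁ ∈ T₁ K, 0 < u K τ₁)
    (hRM : ∀ K t, |t| ≤ l₀ → ∀ τ ∈ T₁ K ×ˢ T₂ K,
      |(Real.log (B K t τ) - Real.log (B K 0 τ)) - (Real.log (A K t τ) - Real.log (A K 0 τ))| ≤ r K)
    (hB0 : ∀ K, ∀ τ ∈ T₁ K ×ˢ T₂ K, B K 0 τ = u K τ.1 * A K 0 τ)
    (hMIX : ∀ K, ∀ τ ∈ T₁ K ×ˢ T₂ K, |Real.log (A K 0 τ) - Real.log (a₁ K τ.1 * μ K τ.2)| ≤ s K / 2)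
    (hLOC : ∀ K t, |t| ≤ l₀ → ∀ τ ∈ T₁ K ×ˢ T₂ K, |Real.log (A K t τ) - Real.log (A K 0 τ) - Real.log (ρbar K t τ.2)| ≤ s' K)
    (hZA : ∀ K t, |t| ≤ l₀ → Z K t = ∑ τ ∈ T₁ K ×ˢ T₂ K, A K t τ)
    (hZB : ∀ K t, |t| ≤ l₀ → Z (K + 1) t = ∑ τ ∈ T₁ K ×ˢ T₂ K, B K t τ)
    (hbud : ∀ K, r K + 2 * (s K + s' K) ≤ vol * δ K) (hδ : Summable δ) : NE7.Target vol l₀ δ Z :=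
  target_of_responseDecorrelationReading hl₀ (fun K => T₁ K ×ˢ T₂ K) A B r (fun K => 2 * (s K + s' K))
    (fun K => Finset.Nonempty.product (hT₁ K) (hT₂ K)) hA hB hRM
    (fun K _ ht => decorrelation_of_quasiProduct_of_localResponse (hT₁ K) (hT₂ K) (hA K) hl₀ (ha₁ K) (hμ K) (hρ K) (hu K) (hB0 K)
      (hMIX K) (hLOC K) ht)
    hZA hZB hbud hδ

end AlongK

/-! ## §4 Sanity: (MIX) and (LOC) are jointly inhabited with `s = s' = 0` (content-free) -/

/-- SANITY (A6): an exact product law with a recent-only response — `A_t(τ₁,τ₂) = a₁ τ₁ · μ τ₂ · ρ̄_t τ₂`, `ρ̄_0 = 1` — satisfies (MIX) with `s = 0` and (LOC) with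
`s' = 0` on any finite `T₁ ×ˢ T₂`.  Shows joint satisfiability only. [folklore] -/
example {T₁ : Finset ι₁} {T₂ : Finset ι₂} {a₁ : ι₁ → ℝ} {μ : ι₂ → ℝ} {ρbar : ℝ → ι₂ → ℝ} (ha₁ : ∀ τ₁ ∈ T₁, 0 < a₁ τ₁)
    (hμ : ∀ τ₂ ∈ T₂, 0 < μ τ₂) (hρ : ∀ t, ∀ τ₂ ∈ T₂, 0 < ρbar t τ₂) (hρ0 : ∀ τ₂ ∈ T₂, ρbar 0 τ₂ = 1) :
    (∀ τ ∈ T₁ ×ˢ T₂, |Real.log ((fun (t : ℝ) (τ : ι₁ × ι₂) => a₁ τ.1 * μ τ.2 * ρbar t τ.2) 0 τ) - Real.log (a₁ τ.1 * μ τ.2)| ≤ (0 : ℝ) / 2) ∧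
    (∀ t : ℝ, ∀ τ ∈ T₁ ×ˢ T₂, |Real.log ((fun (t : ℝ) (τ : ι₁ × ι₂) => a₁ τ.1 * μ τ.2 * ρbar t τ.2) t τ) -
        Real.log ((fun (t : ℝ) (τ : ι₁ × ι₂) => a₁ τ.1 * μ τ.2 * ρbar t τ.2) 0 τ) - Real.log (ρbar t τ.2)| ≤ 0) := by
  constructor
  · intro τ hτ
    obtain ⟨h1, h2⟩ := Finset.mem_product.1 hτ
    simp [hρ0 τ.2 h2]
  · intro t τ hτ
    obtain ⟨h1, h2⟩ := Finset.mem_product.1 hτ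
    have hp : 0 < a₁ τ.1 * μ τ.2 := mul_pos (ha₁ τ.1 h1) (hμ τ.2 h2)
    simp only
    rw [hρ0 τ.2 h2, mul_one, Real.log_mul hp.ne' (hρ t τ.2 h2).ne']
    simp

/-! ## §5 (v1.1, append-only) QUASI-OLD CONTRAST: the two-run contrast reads the old coordinate only UP TO `ζ` — recent two-run contrast + two-hole errors enter as `2ζ` -/

section QuasiOld

variable {T₁ : Finset ι₁} {T₂ : Finset ι₂} {A B : ℝ → ι₁ × ι₂ → ℝ} {a₁ u : ι₁ → ℝ} {μ : ι₂ → ℝ} {ρbar : ℝ → ι₂ → ℝ} {l₀ s s' ζ : ℝ}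

/-- **(DC) FROM (MIX) + (LOC) + A QUASI-OLD CONTRAST** (v1.1; `κ = 2(s + s' + ζ)`).  As §2, but the two-run source-free contrast need only read the old coordinate UP TO
`ζ`: `|log B_0(τ) − log(u(τ₁)·A_0(τ))| ≤ ζ`.  In the class-gas reading `ζ` collects (i) the two-run contrast of the RECENT structure (recent block factors and the gas
near the recent holes — small in the T4 design, where recent = born late) and (ii) both runs' two-hole decoupling errors (FILE H §3 for run A and for run B); the OLD
contrast `u(τ₁)` stays arbitrary.  Proof: the four sums of the (DC)-expression are each within `e^{±}` of the factorised references `(Σ a₁u)(Σ μρ̄_t)`, `(Σ a₁u)(Σ μ)`,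
`(Σ a₁)(Σ μρ̄_t)`, `(Σ a₁)(Σ μ)` (FILE C's `abs_log_sum_sub_log_sum_sub_le` on `T₁ ×ˢ T₂`). [folklore] -/
theorem decorrelation_of_quasiProduct_of_localResponse_of_quasiOldContrast (hT₁ : T₁.Nonempty) (hT₂ : T₂.Nonempty)
    (hA : ∀ t, |t| ≤ l₀ → ∀ τ ∈ T₁ ×ˢ T₂, 0 < A t τ) (hB0 : ∀ τ ∈ T₁ ×ˢ T₂, 0 < B 0 τ) (hl₀ : 0 ≤ l₀) (ha₁ : ∀ τ₁ ∈ T₁, 0 < a₁ τ₁)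
    (hμ : ∀ τ₂ ∈ T₂, 0 < μ τ₂) (hρ : ∀ t, |t| ≤ l₀ → ∀ τ₂ ∈ T₂, 0 < ρbar t τ₂) (hu : ∀ τ₁ ∈ T₁, 0 < u τ₁)
    (hQO : ∀ τ ∈ T₁ ×ˢ T₂, |Real.log (B 0 τ) - Real.log (u τ.1 * A 0 τ)| ≤ ζ)
    (hMIX : ∀ τ ∈ T₁ ×ˢ T₂, |Real.log (A 0 τ) - Real.log (a₁ τ.1 * μ τ.2)| ≤ s / 2)
    (hLOC : ∀ t, |t| ≤ l₀ → ∀ τ ∈ T₁ ×ˢ T₂, |Real.log (A t τ) - Real.log (A 0 τ) - Real.log (ρbar t τ.2)| ≤ s')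
    {t : ℝ} (ht : |t| ≤ l₀) :
    |Real.log (∑ τ ∈ T₁ ×ˢ T₂, B 0 τ * (A t τ / A 0 τ)) - Real.log (∑ τ ∈ T₁ ×ˢ T₂, B 0 τ) -
        (Real.log (∑ τ ∈ T₁ ×ˢ T₂, A t τ) - Real.log (∑ τ ∈ T₁ ×ˢ T₂, A 0 τ))| ≤ 2 * (s + s' + ζ) := by
  have h0 : |(0 : ℝ)| ≤ l₀ := by simpa using hl₀
  have hT : (T₁ ×ˢ T₂).Nonempty := Finset.Nonempty.product hT₁ hT₂
  have mem : ∀ {τ : ι₁ × ι₂}, τ ∈ T₁ ×ˢ T₂ → τ.1 ∈ T₁ ∧ τ.2 ∈ T₂ := fun hτ => Finset.mem_product.1 hτ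
  -- reference products and their factorised sums
  have hprod : ∀ (f : ι₁ → ℝ) (g : ι₂ → ℝ), ∑ τ ∈ T₁ ×ˢ T₂, f τ.1 * g τ.2 = (∑ τ₁ ∈ T₁, f τ₁) * ∑ τ₂ ∈ T₂, g τ₂ := by
    intro f g
    rw [Finset.sum_product, Finset.sum_mul]
    exact Finset.sum_congr rfl fun τ₁ _ => by rw [Finset.mul_sum]
  -- (1) `Σ B_0 · A_t/A_0` against `Σ (a₁ u)(μ ρ̄)`: termwise `log(B_0 A_t/A_0) − log(a₁u·μρ̄) = [log B_0 − log(u A_0)] + [log A_t − log A_0 − log ρ̄] + [log A_0 − log(a₁μ)]`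
  have h1 : |Real.log (∑ τ ∈ T₁ ×ˢ T₂, B 0 τ * (A t τ / A 0 τ)) - Real.log (∑ τ ∈ T₁ ×ˢ T₂, (a₁ τ.1 * u τ.1) * (μ τ.2 * ρbar t τ.2)) - 0| ≤
      ζ + s' + s / 2 := by
    refine abs_log_sum_sub_log_sum_sub_le hT (fun τ hτ => mul_pos (mul_pos (ha₁ _ (mem hτ).1) (hu _ (mem hτ).1)) (mul_pos (hμ _ (mem hτ).2) (hρ t ht _ (mem hτ).2)))
      (fun τ hτ => mul_pos (hB0 τ hτ) (div_pos (hA t ht τ hτ) (hA 0 h0 τ hτ))) fun τ hτ => ?_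
    obtain ⟨h1m, h2m⟩ := mem hτ
    rw [sub_zero, Real.log_mul (hB0 τ hτ).ne' (div_pos (hA t ht τ hτ) (hA 0 h0 τ hτ)).ne', Real.log_div (hA t ht τ hτ).ne' (hA 0 h0 τ hτ).ne',
      Real.log_mul (mul_pos (ha₁ _ h1m) (hu _ h1m)).ne' (mul_pos (hμ _ h2m) (hρ t ht _ h2m)).ne', Real.log_mul (ha₁ _ h1m).ne' (hu _ h1m).ne',
      Real.log_mul (hμ _ h2m).ne' (hρ t ht _ h2m).ne']
    have hq := hQO τ hτ
    rw [Real.log_mul (hu _ h1m).ne' (hA 0 h0 τ hτ).ne'] at hq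
    have hmx := hMIX τ hτ
    rw [Real.log_mul (ha₁ _ h1m).ne' (hμ _ h2m).ne'] at hmx
    have hl := hLOC t ht τ hτ
    have e : Real.log (B 0 τ) + (Real.log (A t τ) - Real.log (A 0 τ)) -
        (Real.log (a₁ τ.1) + Real.log (u τ.1) + (Real.log (μ τ.2) + Real.log (ρbar t τ.2))) =
        (Real.log (B 0 τ) - (Real.log (u τ.1) + Real.log (A 0 τ))) + (Real.log (A t τ) - Real.log (A 0 τ) - Real.log (ρbar t τ.2)) +
          (Real.log (A 0 τ) - (Real.log (a₁ τ.1) + Real.log (μ τ.2))) := by ring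
    rw [e]
    calc _ ≤ |Real.log (B 0 τ) - (Real.log (u τ.1) + Real.log (A 0 τ))| + |Real.log (A t τ) - Real.log (A 0 τ) - Real.log (ρbar t τ.2)| +
          |Real.log (A 0 τ) - (Real.log (a₁ τ.1) + Real.log (μ τ.2))| := abs_add_three _ _ _
      _ ≤ ζ + s' + s / 2 := add_le_add (add_le_add hq hl) hmx
  -- (2) `Σ B_0` against `Σ (a₁u) μ`
  have h2 : |Real.log (∑ τ ∈ T₁ ×ˢ T₂, B 0 τ) - Real.log (∑ τ ∈ T₁ ×ˢ T₂, (a₁ τ.1 * u τ.1) * μ τ.2) - 0| ≤ ζ + s / 2 := by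
    refine abs_log_sum_sub_log_sum_sub_le hT (fun τ hτ => mul_pos (mul_pos (ha₁ _ (mem hτ).1) (hu _ (mem hτ).1)) (hμ _ (mem hτ).2)) hB0 fun τ hτ => ?_
    obtain ⟨h1m, h2m⟩ := mem hτ
    rw [sub_zero, Real.log_mul (mul_pos (ha₁ _ h1m) (hu _ h1m)).ne' (hμ _ h2m).ne', Real.log_mul (ha₁ _ h1m).ne' (hu _ h1m).ne']
    have hq := hQO τ hτ
    rw [Real.log_mul (hu _ h1m).ne' (hA 0 h0 τ hτ).ne'] at hq
    have hmx := hMIX τ hτ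
    rw [Real.log_mul (ha₁ _ h1m).ne' (hμ _ h2m).ne'] at hmx
    have e : Real.log (B 0 τ) - (Real.log (a₁ τ.1) + Real.log (u τ.1) + Real.log (μ τ.2)) =
        (Real.log (B 0 τ) - (Real.log (u τ.1) + Real.log (A 0 τ))) + (Real.log (A 0 τ) - (Real.log (a₁ τ.1) + Real.log (μ τ.2))) := by ring
    rw [e]
    exact (abs_add_le _ _).trans (add_le_add hq hmx)
  -- (3) `Σ A_t` against `Σ a₁ (μ ρ̄)` and (4) `Σ A_0` against `Σ a₁ μ`
  have h3 : |Real.log (∑ τ ∈ T₁ ×ˢ T₂, A t τ) - Real.log (∑ τ ∈ T₁ ×ˢ T₂, a₁ τ.1 * (μ τ.2 * ρbar t τ.2)) - 0| ≤ s' + s / 2 := by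
    refine abs_log_sum_sub_log_sum_sub_le hT (fun τ hτ => mul_pos (ha₁ _ (mem hτ).1) (mul_pos (hμ _ (mem hτ).2) (hρ t ht _ (mem hτ).2)))
      (fun τ hτ => hA t ht τ hτ) fun τ hτ => ?_
    obtain ⟨h1m, h2m⟩ := mem hτ
    rw [sub_zero, Real.log_mul (ha₁ _ h1m).ne' (mul_pos (hμ _ h2m) (hρ t ht _ h2m)).ne', Real.log_mul (hμ _ h2m).ne' (hρ t ht _ h2m).ne']
    have hmx := hMIX τ hτ
    rw [Real.log_mul (ha₁ _ h1m).ne' (hμ _ h2m).ne'] at hmx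
    have hl := hLOC t ht τ hτ
    have e : Real.log (A t τ) - (Real.log (a₁ τ.1) + (Real.log (μ τ.2) + Real.log (ρbar t τ.2))) =
        (Real.log (A t τ) - Real.log (A 0 τ) - Real.log (ρbar t τ.2)) + (Real.log (A 0 τ) - (Real.log (a₁ τ.1) + Real.log (μ τ.2))) := by ring
    rw [e]
    exact (abs_add_le _ _).trans (add_le_add hl hmx)
  have h4 : |Real.log (∑ τ ∈ T₁ ×ˢ T₂, A 0 τ) - Real.log (∑ τ ∈ T₁ ×ˢ T₂, a₁ τ.1 * μ τ.2) - 0| ≤ s / 2 := by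
    refine abs_log_sum_sub_log_sum_sub_le hT (fun τ hτ => mul_pos (ha₁ _ (mem hτ).1) (hμ _ (mem hτ).2)) (fun τ hτ => hA 0 h0 τ hτ) fun τ hτ => ?_
    rw [sub_zero]; exact hMIX τ hτ
  -- factorise the references
  rw [hprod (fun τ₁ => a₁ τ₁ * u τ₁) (fun τ₂ => μ τ₂ * ρbar t τ₂)] at h1
  rw [hprod (fun τ₁ => a₁ τ₁ * u τ₁) μ] at h2
  rw [hprod a₁ (fun τ₂ => μ τ₂ * ρbar t τ₂)] at h3
  rw [hprod a₁ μ] at h4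
  have pau : 0 < ∑ τ₁ ∈ T₁, a₁ τ₁ * u τ₁ := Finset.sum_pos (fun τ₁ h => mul_pos (ha₁ τ₁ h) (hu τ₁ h)) hT₁
  have pa : 0 < ∑ τ₁ ∈ T₁, a₁ τ₁ := Finset.sum_pos ha₁ hT₁
  have pμρ : 0 < ∑ τ₂ ∈ T₂, μ τ₂ * ρbar t τ₂ := Finset.sum_pos (fun τ₂ h => mul_pos (hμ τ₂ h) (hρ t ht τ₂ h)) hT₂
  have pμ : 0 < ∑ τ₂ ∈ T₂, μ τ₂ := Finset.sum_pos hμ hT₂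
  rw [Real.log_mul pau.ne' pμρ.ne'] at h1
  rw [Real.log_mul pau.ne' pμ.ne'] at h2
  rw [Real.log_mul pa.ne' pμρ.ne'] at h3
  rw [Real.log_mul pa.ne' pμ.ne'] at h4
  rw [abs_le] at h1 h2 h3 h4 ⊢
  constructor <;> linarith [h1.1, h1.2, h2.1, h2.2, h3.1, h3.2, h4.1, h4.2]

end QuasiOld

end Summit.QuantumFields.YangMills.BalabanUVNodes.N19AgingLetterOfMixingLocality

end
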